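import Literature.Probability.LatticeModels.IndependencePolynomial
import Literature.Computability.QuantumComplexity.TimeToSolution
import Mathlib.Analysis.SpecialFunctions.Log.Basic
import HarnessLib

/-!
# MIS degeneracies `D_k`, the independence polynomial in coefficient form, and the SA ‘hardness parameter’

Topic `Literature/Combinatorics/Optimization` (pub-qadeq lane, CLAIMS §5 row E-34: Ebadi et al.,
neutral-atom Maximum-Independent-Set optimisation, and its classical counter Andrist et al. 2023).
Companion of `LocalIsing.lean` (same directory: objective / approximation-ratio vocabulary of the
Ising-type rows) and of `Literature/Probability/LatticeModels/IndependencePolynomial.lean`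
(`independencePolynomial G z = ∑_{I independent} z^{#I}`).

HONEST FRAMING: instance-level adjudication of specific advantage claims; no claim about BQP vs BPP
or the summit. Nothing here says anything about any device, algorithm or graph family; the file only
fixes, on Mathlib's `SimpleGraph.indepSetFinset` / `indepNum` / `IsMaximumIndepSet`, the COUNTING
quantities in which the E-34 claim and its counter are stated, with their elementary arithmetic.

## Source statements formalised

* “the independence polynomial, which is defined, for a graph G, as I(G, x) = Σ_{k=0}^{|MIS|} D_k x^k,
  where the polynomial coefficient D_i denotes the degeneracy of independent sets of size k.
  Therefore, if we can compute the independence polynomial, the coefficients D_{|MIS|} and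
  D_{|MIS|−1} tell us the degeneracies of the MIS and of the independent sets of size |MIS|−1,
  respectively.” [cite: EbadiEtAl2022, Supplementary Materials §6 (first display)]
* “its total number of MIS solutions, which we refer to as the MIS degeneracy D_{|MIS|}”; “the
  logarithm of the MIS degeneracy normalized by the graph size, ρ ≡ log(D_{|MIS|})/N. This quantity,
  a measure of MIS degeneracy density, …” [cite: EbadiEtAl2022, main text ‘Quantum Optimization on
  Different Graphs’]
* “the approximation ratio R ≡ ⟨Σ_i n_i⟩/|MIS|, and the probability P_MIS of observing an MIS (where
  |MIS| denotes the size of the maximum independent set of the graph)”; “the approximation ratio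
  displays a plateau at R = (|MIS|−1)/|MIS|, corresponding to independent sets with one less vertex
  than the MIS … Graphs displaying this behaviour have a large number of local minima with
  independent set size |MIS|−1, in which SA can be trapped up to large depths. … the ability of SA
  to find a global optimum is limited by the ratio of the number of suboptimal independent sets of
  size |MIS|−1 to the number of ways to reach global minima, resulting in a “hardness parameter”
  HP = D_{|MIS|−1}/(|MIS| D_{|MIS|})” [cite: EbadiEtAl2022, main text ‘Closed-loop Variational
  Optimization’ and ‘Benchmarking Against Simulated Annealing’]
* “the conductance-like hardness parameter H = D_{MIS−1}/(|MIS| · D_{MIS}), (3) with the factor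
  |MIS| D_{MIS} denoting the number of possible transitions from a first excited state into a MIS
  ground state” [cite: AndristEtAl2023, §II eq. (3)].

## Contents (all proved; 0 named facts)

* `indepCount G k = #(G.indepSetFinset k)` (`D_k`); `indepCount_eq_zero_of_indepNum_lt` (no
  independent set is larger than `|MIS| = G.indepNum`), `indepCount_zero = 1`.
* `misDegeneracy G = D_{|MIS|}` with `mem_indepSetFinset_indepNum_iff` (**`D_{|MIS|}` counts exactly
  Mathlib's maximum independent sets**) and `misDegeneracy_pos`; `subMISDegeneracy G = D_{|MIS|−1}`.
* **Coefficient form of the independence polynomial**: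
  `independencePolynomial_eq_sum_indepCount` — the tree's `∑_{I independent} z^{#I}` equals
  `∑_{k ≤ |V|} D_k z^k`, and `independencePolynomial_eq_sum_range_indepNum` (the printed upper limit
  `|MIS|`); `independencePolynomial_one_eq` (at `z = 1`: the total number of independent sets).
* `hardnessParam G = D_{|MIS|−1}/(|MIS| · D_{|MIS|}) : ℚ`; `degeneracyDensity G = log(D_{|MIS|})/N : ℝ`
  with `0 ≤ ρ ≤ log 2` (`misDegeneracy_le_two_pow`).
* The denominator: `transitions G` = the pairs `(M, v)` with `M` a maximum independent set and
  `v ∈ M`, `card_transitions = |MIS| · D_{|MIS|}` (Andrist et al.'s reading of the factor), and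
  `erase_mem_indepSetFinset_of_mem_transitions` (each transition lands on a first excited state).
* The numerator versus SA traps (an elementary consequence of the two printed definitions, stated
  here for the lane's reports and NOT printed as an inequality in either source): `IsTrap G T` — an
  independent set of size `|MIS|−1` no single added vertex makes independent (a ‘local minimum with
  independent set size |MIS|−1’); `subMISDegeneracy_le_card_traps_add` : `D_{|MIS|−1} ≤ #traps +
  |MIS|·D_{|MIS|}`, i.e. **`(HP − 1) · |MIS| · D_{|MIS|} ≤ #traps ≤ HP · |MIS| · D_{|MIS|}`**
  (`hardnessParam_sub_one_mul_le_card_traps`, `card_traps_le`): a hardness parameter above `1`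
  forces at least `(HP − 1)|MIS| D_{|MIS|}` genuine traps.
* Metrics: `misRatio G s = #s/|MIS|` with `misRatio_le_one` (independent `s`), `misRatio_eq_one_iff`
  (`= 1` iff `s` is a maximum independent set), `misRatio_of_mem_indepSetFinset_pred` (the plateau
  value `(|MIS|−1)/|MIS|`); `pMIS` (empirical probability that a sample is an MIS) with `0 ≤ · ≤ 1`.
* NOT typed here: the SM §11 Cheeger-type bound `δ_min^SA ≤ poly(N)·HP⁻¹` on the spectral gap of
  MIS simulated annealing (a Markov-chain statement with an unspecified polynomial), the tensor-
  network contraction of §6, and anything about unit-disk / King's-lattice graph families.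

## References

* [EbadiEtAl2022] S. Ebadi et al., *Quantum optimization of maximum independent set using Rydberg
  atom arrays*, Science 376, 1209–1215 (2022), doi:10.1126/science.abo6587 = arXiv:2202.09372: main
  text §§‘Closed-loop Variational Optimization’, ‘Quantum Optimization on Different Graphs’,
  ‘Benchmarking Against Simulated Annealing’; Supplementary Materials §6 ‘Characterizing Graphs
  using Tensor Network Algorithms’, §11. Read via `lit read arxiv:2202.09372` (held LaTeX text, chunks
  p0003 L2, p0004 L1–L13, p0013 L3–L47, p0019–p0020).
* [AndristEtAl2023] R. S. Andrist et al., *Hardness of the maximum-independent-set problem on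
  unit-disk graphs and prospects for quantum speedups*, Phys. Rev. Research 5, 043277 (2023),
  doi:10.1103/physrevresearch.5.043277 = arXiv:2307.09442: §II eqs. (3)–(4) (fetched PDF text p0003
  L53–L80), §IV.B (p0007 L36–L70).
-/

noncomputable section

open Finset SimpleGraph

namespace Literature.Combinatorics.Optimization

namespace MISHardness

variable {V : Type*} [Fintype V] [DecidableEq V] (G : SimpleGraph V) [DecidableRel G.Adj]

/-! ### Degeneracies `D_k` -/

/-- `D_k`: the number of independent sets of size `k` (“the degeneracy of independent sets of size
k”), on Mathlib's `indepSetFinset`. [cite: EbadiEtAl2022, Supplementary Materials §6 (coefficients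
`D_k` of the first display)] [cite: AndristEtAl2023, §II (D_MIS, D_{MIS−1})] -/
def indepCount (k : ℕ) : ℕ := (G.indepSetFinset k).card

/-- `D_0 = 1` (the empty set). [cite: EbadiEtAl2022, Supplementary Materials §6 (`k = 0` term)] -/
theorem indepCount_zero : indepCount G 0 = 1 := by
  rw [indepCount, card_eq_one]
  refine ⟨∅, ?_⟩
  ext s
  simp only [mem_indepSetFinset_iff, isNIndepSet_iff, card_eq_zero, Finset.mem_singleton]
  constructor
  · rintro ⟨-, h⟩; exact h
  · rintro rfl; exact ⟨by simp [isIndepSet_iff], rfl⟩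

/-- No independent set is larger than `|MIS| = indepNum`: `D_k = 0` for `k > |MIS|` (so the printed
sum `Σ_{k=0}^{|MIS|}` loses nothing). [cite: EbadiEtAl2022, Supplementary Materials §6 (upper limit
`|MIS|` of the first display)] -/
theorem indepCount_eq_zero_of_indepNum_lt {k : ℕ} (hk : G.indepNum < k) : indepCount G k = 0 := by
  rw [indepCount, card_eq_zero, eq_empty_iff_forall_notMem]
  intro s hs
  rw [mem_indepSetFinset_iff, isNIndepSet_iff] at hs
  have := hs.1.card_le_indepNum
  omega

/-- The MIS degeneracy `D_{|MIS|}`: “its total number of MIS solutions”.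
[cite: EbadiEtAl2022, main text ‘Quantum Optimization on Different Graphs’ (D_{|MIS|})]
[cite: AndristEtAl2023, §II (“the MIS degeneracy … D_MIS”)] -/
def misDegeneracy : ℕ := indepCount G G.indepNum

/-- `D_{|MIS|−1}`: the number of independent sets with one vertex fewer than an MIS (“first excited
states”). [cite: EbadiEtAl2022, Supplementary Materials §6] [cite: AndristEtAl2023, §II (“the
quantity D_{MIS−1} refers to the number of first excited states (i.e., independent sets of size
|MIS|−1)”)] -/
def subMISDegeneracy : ℕ := indepCount G (G.indepNum - 1)

/-- **`D_{|MIS|}` counts exactly the maximum independent sets**: an independent set of size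
`indepNum` is Mathlib's `IsMaximumIndepSet`, and conversely.
[cite: EbadiEtAl2022, main text (“where |MIS| denotes the size of the maximum independent set of the
graph”)] -/
theorem mem_indepSetFinset_indepNum_iff (s : Finset V) :
    s ∈ G.indepSetFinset G.indepNum ↔ G.IsMaximumIndepSet s := by
  rw [mem_indepSetFinset_iff, isNIndepSet_iff, isMaximumIndepSet_iff]
  constructor
  · rintro ⟨hind, hcard⟩
    exact ⟨hind, fun t ht => hcard ▸ ht.card_le_indepNum⟩
  · rintro ⟨hind, hmax⟩
    exact ⟨hind, maximumIndepSet_card_eq_indepNum s ⟨hind, hmax⟩⟩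

/-- `D_{|MIS|} ≥ 1`: a maximum independent set exists. [cite: EbadiEtAl2022, main text ‘Quantum
Optimization on Different Graphs’] -/
theorem misDegeneracy_pos : 0 < misDegeneracy G := by
  obtain ⟨s, hs⟩ := G.exists_isNIndepSet_indepNum
  exact card_pos.2 ⟨s, mem_indepSetFinset_iff.2 hs⟩

/-- `D_{|MIS|} ≤ 2^N` (independent sets are vertex subsets). [folklore] -/
private theorem misDegeneracy_le_two_pow : misDegeneracy G ≤ 2 ^ Fintype.card V := by
  calc misDegeneracy G ≤ (univ : Finset (Finset V)).card := card_le_univ _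
    _ = 2 ^ Fintype.card V := by rw [card_univ, Fintype.card_finset]

/-! ### The independence polynomial in coefficient form -/

/-- **Coefficient form.** The tree's independence polynomial `∑_{I independent} z^{#I}`
(`Literature.Probability.LatticeModels.independencePolynomial`) equals `Σ_{k=0}^{|V|} D_k z^k`.
[cite: EbadiEtAl2022, Supplementary Materials §6 (“I(G, x) = Σ_{k=0}^{|MIS|} D_k x^k, where the
polynomial coefficient D_i denotes the degeneracy of independent sets of size k”)] -/
theorem independencePolynomial_eq_sum_indepCount {R : Type*} [CommSemiring R] (z : R) :
    Literature.Probability.LatticeModels.independencePolynomial G z =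
      ∑ k ∈ range (Fintype.card V + 1), (indepCount G k : R) * z ^ k := by
  classical
  rw [Literature.Probability.LatticeModels.independencePolynomial, ← sum_filter]
  symm
  rw [← sum_fiberwise_of_maps_to (s := univ.filter fun I : Finset V => G.IsIndepSet (I : Set V))
    (t := range (Fintype.card V + 1)) (g := fun I => I.card)
    (fun I _ => mem_range.2 (Nat.lt_succ_of_le (card_le_univ I)))]
  refine sum_congr rfl fun k _ => ?_
  have hset : (univ.filter fun I : Finset V => G.IsIndepSet (I : Set V)).filter (fun I => I.card = k)
      = G.indepSetFinset k := by
    ext I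
    simp only [mem_filter, mem_univ, true_and, mem_indepSetFinset_iff, isNIndepSet_iff]
  rw [hset, indepCount]
  calc (((G.indepSetFinset k).card : ℕ) : R) * z ^ k = ∑ _I ∈ G.indepSetFinset k, z ^ k := by
        rw [sum_const, nsmul_eq_mul]
    _ = ∑ I ∈ G.indepSetFinset k, z ^ I.card :=
        sum_congr rfl fun I hI => by
          rw [((mem_indepSetFinset_iff).1 hI).card_eq]

/-- The printed range: `I(G, z) = Σ_{k=0}^{|MIS|} D_k z^k`.
[cite: EbadiEtAl2022, Supplementary Materials §6 (first display)] -/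
theorem independencePolynomial_eq_sum_range_indepNum {R : Type*} [CommSemiring R] (z : R) :
    Literature.Probability.LatticeModels.independencePolynomial G z =
      ∑ k ∈ range (G.indepNum + 1), (indepCount G k : R) * z ^ k := by
  rw [independencePolynomial_eq_sum_indepCount]
  have hle : G.indepNum + 1 ≤ Fintype.card V + 1 := by
    obtain ⟨s, hs⟩ := G.exists_isNIndepSet_indepNum
    have := hs.card_eq ▸ card_le_univ s
    omega
  rw [← sum_range_add_sum_Ico _ hle]
  have h0 : ∑ k ∈ Ico (G.indepNum + 1) (Fintype.card V + 1), (indepCount G k : R) * z ^ k = 0 := by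
    refine sum_eq_zero fun k hk => ?_
    rw [indepCount_eq_zero_of_indepNum_lt G (by have := (mem_Ico.1 hk).1; omega), Nat.cast_zero,
      zero_mul]
  rw [h0, add_zero]

/-- At `z = 1` the independence polynomial is the total number of independent sets `Σ_k D_k`.
[cite: EbadiEtAl2022, Supplementary Materials §6 (“the total number of independent sets, and the
independence polynomial”)] -/
theorem independencePolynomial_one_eq :
    Literature.Probability.LatticeModels.independencePolynomial G (1 : ℕ) =
      ∑ k ∈ range (Fintype.card V + 1), indepCount G k := by
  simp [independencePolynomial_eq_sum_indepCount]

/-! ### Hardness parameter and degeneracy density -/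

/-- **The hardness parameter** `HP = D_{|MIS|−1}/(|MIS| · D_{|MIS|})`.
[cite: EbadiEtAl2022, main text ‘Benchmarking Against Simulated Annealing’ (“resulting in a
“hardness parameter” HP = D_{|MIS|−1}/(|MIS| D_{|MIS|})”)] [cite: AndristEtAl2023, §II eq. (3)] -/
def hardnessParam : ℚ := (subMISDegeneracy G : ℚ) / ((G.indepNum : ℚ) * misDegeneracy G)

/-- `HP ≥ 0`. [cite: AndristEtAl2023, §II eq. (3)] -/
theorem hardnessParam_nonneg : 0 ≤ hardnessParam G := by
  unfold hardnessParam; positivity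

/-- **The degeneracy density** `ρ ≡ log(D_{|MIS|})/N`.
[cite: EbadiEtAl2022, main text ‘Quantum Optimization on Different Graphs’ (“ρ ≡ log(D_{|MIS|})/N.
This quantity, a measure of MIS degeneracy density”)] -/
noncomputable def degeneracyDensity : ℝ := Real.log (misDegeneracy G) / Fintype.card V

/-- `ρ ≥ 0` (`D_{|MIS|} ≥ 1`). [cite: EbadiEtAl2022, main text ‘Quantum Optimization on Different
Graphs’] -/
theorem degeneracyDensity_nonneg : 0 ≤ degeneracyDensity G := by
  unfold degeneracyDensity
  refine div_nonneg (Real.log_nonneg ?_) (Nat.cast_nonneg _)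
  exact_mod_cast misDegeneracy_pos G

/-- `ρ ≤ log 2` (`D_{|MIS|} ≤ 2^N`). [cite: EbadiEtAl2022, main text ‘Quantum Optimization on
Different Graphs’] -/
theorem degeneracyDensity_le_log_two : degeneracyDensity G ≤ Real.log 2 := by
  unfold degeneracyDensity
  rcases Nat.eq_zero_or_pos (Fintype.card V) with h0 | hpos
  · simp [h0]; positivity
  · rw [div_le_iff₀ (by exact_mod_cast hpos), mul_comm, ← Real.log_pow]
    refine Real.log_le_log (by exact_mod_cast misDegeneracy_pos G) ?_
    exact_mod_cast misDegeneracy_le_two_pow G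

/-! ### The denominator `|MIS| · D_{|MIS|}`: transitions into the ground manifold -/

/-- The pairs `⟨M, v⟩` with `M` a maximum independent set and `v ∈ M`: removing `v` from `M` is one
“possible transition from a first excited state into a MIS ground state”, read backwards.
[cite: AndristEtAl2023, §II eq. (3) (“with the factor |MIS| D_MIS denoting the number of possible
transitions from a first excited state into a MIS ground state”)] -/
def transitions : Finset ((_ : Finset V) × V) :=
  (G.indepSetFinset G.indepNum).sigma fun M => M

/-- Membership in `transitions`. [cite: AndristEtAl2023, §II eq. (3)] -/
theorem mem_transitions_iff (p : (_ : Finset V) × V) :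
    p ∈ transitions G ↔ p.1 ∈ G.indepSetFinset G.indepNum ∧ p.2 ∈ p.1 :=
  mem_sigma

/-- **`#transitions = |MIS| · D_{|MIS|}`.** [cite: AndristEtAl2023, §II eq. (3) (the factor
`|MIS| D_MIS`)] -/
theorem card_transitions : (transitions G).card = G.indepNum * misDegeneracy G := by
  rw [transitions, card_sigma, misDegeneracy, indepCount, mul_comm]
  exact sum_const_nat fun M hM => (mem_indepSetFinset_iff.1 hM).card_eq

/-- Each transition lands on a first excited state: `M ∖ {v}` is an independent set of size
`|MIS| − 1`. [cite: AndristEtAl2023, §II eq. (3)] -/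
theorem erase_mem_indepSetFinset_of_mem_transitions {p : (_ : Finset V) × V}
    (hp : p ∈ transitions G) : p.1.erase p.2 ∈ G.indepSetFinset (G.indepNum - 1) := by
  rw [mem_transitions_iff, mem_indepSetFinset_iff, isNIndepSet_iff] at hp
  obtain ⟨⟨hind, hcard⟩, hv⟩ := hp
  rw [mem_indepSetFinset_iff, isNIndepSet_iff]
  refine ⟨?_, by rw [card_erase_of_mem hv, hcard]⟩
  rw [isIndepSet_iff] at hind ⊢
  exact hind.mono (by exact_mod_cast erase_subset p.2 p.1)

/-! ### The numerator versus SA traps -/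

/-- The SA **traps**: independent sets of size `|MIS| − 1` that no single added vertex turns into a
(maximum) independent set — “local minima with independent set size |MIS|−1, in which SA can be
trapped”. [cite: EbadiEtAl2022, main text ‘Benchmarking Against Simulated Annealing’] -/
def traps : Finset (Finset V) :=
  (G.indepSetFinset (G.indepNum - 1)).filter fun T =>
    ∀ v, v ∉ T → ¬ G.IsNIndepSet G.indepNum (insert v T)

/-- Membership in `traps`. [cite: EbadiEtAl2022, main text ‘Benchmarking Against Simulated
Annealing’] -/
theorem mem_traps_iff (T : Finset V) :
    T ∈ traps G ↔ T ∈ G.indepSetFinset (G.indepNum - 1) ∧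
      ∀ v, v ∉ T → ¬ G.IsNIndepSet G.indepNum (insert v T) := by
  simp only [traps, mem_filter]

/-- Every trap is a first excited state: `#traps ≤ D_{|MIS|−1}`.
[cite: EbadiEtAl2022, main text ‘Benchmarking Against Simulated Annealing’] -/
theorem card_traps_le : (traps G).card ≤ subMISDegeneracy G :=
  card_filter_le _ _

/-- **`D_{|MIS|−1} ≤ #traps + |MIS| · D_{|MIS|}`**: a first excited state that is not a trap is
`M ∖ {v}` for some transition `⟨M, v⟩`. An elementary consequence of the two printed definitions,
stated here for the lane's reports and NOT printed as an inequality in either source.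
[cite: EbadiEtAl2022, main text ‘Benchmarking Against Simulated Annealing’ (“the ratio of the
number of suboptimal independent sets of size |MIS|−1 to the number of ways to reach global
minima”)] [cite: AndristEtAl2023, §II eq. (3)] -/
theorem subMISDegeneracy_le_card_traps_add :
    subMISDegeneracy G ≤ (traps G).card + G.indepNum * misDegeneracy G := by
  classical
  set P : Finset V → Prop := fun T => ∀ v, v ∉ T → ¬ G.IsNIndepSet G.indepNum (insert v T) with hP
  have hsplit := card_filter_add_card_filter_not (s := G.indepSetFinset (G.indepNum - 1)) P
  have hsub : (G.indepSetFinset (G.indepNum - 1)).filter (fun T => ¬ P T) ⊆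
      (transitions G).image fun p => p.1.erase p.2 := by
    intro T hT
    rw [mem_filter] at hT
    obtain ⟨-, hnot⟩ := hT
    simp only [hP, not_forall, not_not] at hnot
    obtain ⟨v, hv, hM⟩ := hnot
    rw [mem_image]
    refine ⟨⟨insert v T, v⟩, (mem_transitions_iff G _).2 ⟨mem_indepSetFinset_iff.2 hM,
      mem_insert_self v T⟩, ?_⟩
    exact erase_insert hv
  calc subMISDegeneracy G = (traps G).card +
        ((G.indepSetFinset (G.indepNum - 1)).filter (fun T => ¬ P T)).card := by
          rw [subMISDegeneracy, indepCount, ← hsplit, traps]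
    _ ≤ (traps G).card + ((transitions G).image fun p => p.1.erase p.2).card :=
          Nat.add_le_add_left (card_le_card hsub) _
    _ ≤ (traps G).card + (transitions G).card := Nat.add_le_add_left card_image_le _
    _ = (traps G).card + G.indepNum * misDegeneracy G := by rw [card_transitions]

/-- In the printed normalisation: **`(HP − 1) · |MIS| · D_{|MIS|} ≤ #traps`** — a hardness parameter
above `1` forces at least that many genuine traps (for a graph with at least one vertex, so that
`|MIS| ≥ 1`). [cite: EbadiEtAl2022, main text ‘Benchmarking Against Simulated Annealing’]
[cite: AndristEtAl2023, §II eq. (3)] -/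
theorem hardnessParam_sub_one_mul_le_card_traps (hm : 0 < G.indepNum) :
    (hardnessParam G - 1) * ((G.indepNum : ℚ) * misDegeneracy G) ≤ (traps G).card := by
  have hD : (0 : ℚ) < (G.indepNum : ℚ) * misDegeneracy G := by
    have := misDegeneracy_pos G
    positivity
  have h : (subMISDegeneracy G : ℚ) ≤ (traps G).card + (G.indepNum : ℚ) * misDegeneracy G := by
    exact_mod_cast subMISDegeneracy_le_card_traps_add G
  rw [hardnessParam, sub_mul, div_mul_cancel₀ _ hD.ne', one_mul]
  linarith

/-- … and `#traps ≤ HP · |MIS| · D_{|MIS|} = D_{|MIS|−1}`. [cite: EbadiEtAl2022, main text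
‘Benchmarking Against Simulated Annealing’] [cite: AndristEtAl2023, §II eq. (3)] -/
theorem card_traps_le_hardnessParam_mul (hm : 0 < G.indepNum) :
    ((traps G).card : ℚ) ≤ hardnessParam G * ((G.indepNum : ℚ) * misDegeneracy G) := by
  have hD : (0 : ℚ) < (G.indepNum : ℚ) * misDegeneracy G := by
    have := misDegeneracy_pos G
    positivity
  rw [hardnessParam, div_mul_cancel₀ _ hD.ne']
  exact_mod_cast card_traps_le G

omit [DecidableEq V] [DecidableRel G.Adj] in
/-- A graph with a vertex has `|MIS| ≥ 1` (“|MIS| denotes the size of the maximum independent set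
of the graph”; a single vertex is independent). [cite: EbadiEtAl2022, main text ‘Closed-loop
Variational Optimization’] -/
theorem indepNum_pos [Nonempty V] : 0 < G.indepNum := by
  obtain ⟨v⟩ := ‹Nonempty V›
  have h : G.IsIndepSet (({v} : Finset V) : Set V) := by simp [isIndepSet_iff]
  have := h.card_le_indepNum
  rw [card_singleton] at this
  omega

/-! ### Metrics: approximation ratio and `P_MIS` -/

/-- The approximation ratio of one sampled independent set, `#s/|MIS|` (the source averages this
over samples: “R ≡ ⟨Σ_i n_i⟩/|MIS|”). [cite: EbadiEtAl2022, main text ‘Closed-loop Variational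
Optimization’] -/
def misRatio (s : Finset V) : ℚ := (s.card : ℚ) / G.indepNum

omit [DecidableEq V] [DecidableRel G.Adj] in
/-- `R ≤ 1` for an independent sample. [cite: EbadiEtAl2022, main text ‘Closed-loop Variational
Optimization’ (“|MIS| denotes the size of the maximum independent set”)] -/
theorem misRatio_le_one {s : Finset V} (hs : G.IsIndepSet (s : Set V)) : misRatio G s ≤ 1 := by
  unfold misRatio
  rcases Nat.eq_zero_or_pos G.indepNum with h0 | hpos
  · simp [h0]
  · rw [div_le_one (by exact_mod_cast hpos)]
    exact_mod_cast hs.card_le_indepNum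

/-- `R = 1` iff the independent sample is a maximum independent set (`|MIS| ≥ 1`).
[cite: EbadiEtAl2022, main text ‘Closed-loop Variational Optimization’] -/
theorem misRatio_eq_one_iff {s : Finset V} (hs : G.IsIndepSet (s : Set V)) (hm : 0 < G.indepNum) :
    misRatio G s = 1 ↔ G.IsMaximumIndepSet s := by
  rw [← mem_indepSetFinset_indepNum_iff, mem_indepSetFinset_iff, isNIndepSet_iff, misRatio,
    div_eq_one_iff_eq (by exact_mod_cast hm.ne'), Nat.cast_inj]
  exact ⟨fun h => ⟨hs, h⟩, fun h => h.2⟩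

/-- The plateau value: a first excited state has `R = (|MIS| − 1)/|MIS|`.
[cite: EbadiEtAl2022, main text ‘Benchmarking Against Simulated Annealing’ (“a plateau at
R = (|MIS|−1)/|MIS|, corresponding to independent sets with one less vertex than the MIS”)] -/
theorem misRatio_of_mem_indepSetFinset_pred {s : Finset V}
    (hs : s ∈ G.indepSetFinset (G.indepNum - 1)) (hm : 0 < G.indepNum) :
    misRatio G s = ((G.indepNum : ℚ) - 1) / G.indepNum := by
  rw [misRatio, (mem_indepSetFinset_iff.1 hs).card_eq, Nat.cast_sub hm, Nat.cast_one]

/-- The empirical `P_MIS` of a finite family of sampled vertex sets: the fraction that are maximum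
independent sets (“the probability P_MIS of observing an MIS”).
[cite: EbadiEtAl2022, main text ‘Closed-loop Variational Optimization’]
[cite: AndristEtAl2023, §II (“P_MIS refers to the probability of observing an (exact) MIS within a
fixed number of steps”)] -/
def pMIS {ι : Type*} [Fintype ι] (samples : ι → Finset V) : ℚ :=
  ((univ.filter fun i => samples i ∈ G.indepSetFinset G.indepNum).card : ℚ) / Fintype.card ι

/-- `0 ≤ P_MIS`. [cite: EbadiEtAl2022, main text ‘Closed-loop Variational Optimization’] -/
theorem pMIS_nonneg {ι : Type*} [Fintype ι] (samples : ι → Finset V) : 0 ≤ pMIS G samples := by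
  unfold pMIS; positivity

/-- `P_MIS ≤ 1`. [cite: EbadiEtAl2022, main text ‘Closed-loop Variational Optimization’] -/
theorem pMIS_le_one {ι : Type*} [Fintype ι] (samples : ι → Finset V) : pMIS G samples ≤ 1 := by
  unfold pMIS
  rcases Nat.eq_zero_or_pos (Fintype.card ι) with h0 | hpos
  · simp [h0]
  · rw [div_le_one (by exact_mod_cast hpos)]
    exact_mod_cast card_le_univ _

/-! ### `P_MIS` and time-to-solution -/

/-- `TTS99 = τ · R99` with `R99 = log(1 − 0.99)/log(1 − P_MIS)` “the number of shots (repetitions)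
needed to reach the desired success probability”: by definition `τ * repetitionsReal P_MIS 0.99` of
`TimeToSolution.lean` (Rønnow et al.'s count, here without the ceiling, as printed).
[cite: AndristEtAl2023, §II eqs. (4)–(5)] -/
noncomputable def tts99 (τ p : ℝ) : ℝ :=
  τ * Literature.Computability.QuantumComplexity.repetitionsReal p 0.99

/-- The printed formula. [cite: AndristEtAl2023, §II eqs. (4)–(5)] -/
theorem tts99_eq (τ p : ℝ) : tts99 τ p = τ * (Real.log (1 - 0.99) / Real.log (1 - p)) := rfl

/-- “For small values of P_MIS, we have R99 ≈ 4.6/P_MIS, showing that the success probability of a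
single run P_MIS determines the inverse of the time-to-solution” — the exact one-sided form:
`R99 ≤ log(100)/P_MIS` for `0 < P_MIS < 1` (`log 100 = 4.605…`; from `log(1 − p) ≤ −p`).
[cite: AndristEtAl2023, §II (after eq. (5))] -/
theorem repetitionsReal_le_log_div {p : ℝ} (hp0 : 0 < p) (hp1 : p < 1) :
    Literature.Computability.QuantumComplexity.repetitionsReal p 0.99 ≤ Real.log 100 / p := by
  unfold Literature.Computability.QuantumComplexity.repetitionsReal
  have hlog : Real.log (1 - p) ≤ -p := by
    have := Real.log_le_sub_one_of_pos (by linarith : 0 < 1 - p)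
    linarith
  have hneg : Real.log (1 - p) < 0 := by linarith
  have h100 : Real.log (1 - 0.99) = -Real.log 100 := by
    rw [← Real.log_inv]; norm_num
  rw [h100, neg_div, ← div_neg]
  exact div_le_div_of_nonneg_left (Real.log_nonneg (by norm_num)) hp0 (by linarith)

end MISHardness

end Literature.Combinatorics.Optimization

end
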